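import Summits.BirchSwinnertonDyer.BirchSwinnertonDyer.Theorems.GenusKolyvaginAtTwoTorsionCellTorsionControl
import Literature.NumberTheory.EllipticCurves.Curve24A1Descent
import HarnessLib

/-!
# LINE 49 «full_vertex» — TORSION CONTROL over `K″ = ℚ(√D)` ramified at a good prime: Lemma 11.1 UNCONDITIONALLY

Crux R″ `RankOneTwoTorsionResidualAtTwo` (stmt-BirchSwinnertonDyer-27478) of route GenusKolyvaginAtTwo, LINE 49
«torsion_cell_full_vertex_bsdidea1» (pen bsd-idea-1); sequel of `…TorsionCellTorsionControl` (§1–§4, §6a of the pen's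
HOME-only brick `line49/engine/TorsionControl.lean` r3, memo #4 §11).  This file hosts §6–§7, DEF-FREE: the
square-reflection hypothesis of the descent form is DISCHARGED for `K = ℚ`, `L = ℚ(r)`, `r² = D`, `v_p(D)` odd at a prime
`p` with `v_p(eᵢ − eⱼ) = 0` (the Kummer values of rational points have even `p`-adic valuation at such a good prime `p`,
the image half of Silverman AEC X.1.4 via the tree's `Curve24A1.even_padicValRat_sub`; a rational number that becomes a
square in `ℚ(√D)` lies in `ℚ² ∪ Dℚ²`, and the second option has odd `p`-valuation).

* `exists_sq_of_isSquare_quadratic_of_even_padicValRat` — a rational number of even (or undefined: `c = 0`)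
  `p`-valuation that becomes a square in `ℚ(√D)`, `v_p(D)` odd, is a rational square;
* `even_padicValRat_torsionKummerValue`, `even_padicValRat_kummerValue_of_nonsingular` — the Kummer values
  `(e₁−e₂)(e₁−e₃)` and `x − e₁` of rational points are `p`-units up to squares at a good prime `p`;
* **`exists_add_self_of_incl_quadratic`** (Lemma 11.1 (i)): `E(ℚ) ∩ 2E(L) = 2E(ℚ)`;
  **`exists_incl_eq_of_two_pow_smul_eq_zero_quadratic`** (ii): `E(L)[2^∞] = E(ℚ)[2^∞]`;
  **`exists_incl_eq_of_add_self_eq_incl_quadratic`** (iii): halves in `E(L)` of rational points are rational —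
  for `E/ℚ` with rational `2`-torsion `e₁, e₂, e₃` (any model), `L = ℚ(r)`, `r² = D`, `v_p(D)` odd, `v_p(eᵢ − eⱼ) = 0`;
* **`…_cell`** versions: the literal GK2 / LINE 49 reading — `eᵢ ∈ ℤ`, `p₀ ∤ eᵢ − eⱼ`, `p₀ ∤ M₀ ≠ 0`, `r² = −p₀M₀`
  (`K″ = ℚ(√−p₀M₀)`, `p₀` the Heegner prime): `E₀(K″)[2^∞] = E₀(ℚ)[2^∞]` and `E₀(ℚ)` is `2`-saturated in `E₀(K″)` —
  the facts used in memo #4 §11/§12 (F6 table: `torsK = 4` on all rows), now theorems for every such base.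

Everything is proved (no `sorry`, standard axioms); nothing here is a statement of the line, and NOTHING HERE PROVES R″
or any summit — BSD is not advanced by this file alone.  (`2`-primary torsion only; odd torsion growth in `K″` is a
separate, unrelated fact.)

## References

* [SilvermanAEC2009] J. H. Silverman, *The Arithmetic of Elliptic Curves*, 2nd ed., GTM 106 (2009), Prop. X.1.4.
* [Kramer1981] K. Kramer, *Arithmetic of elliptic curves upon quadratic extension*, Trans. AMS 264 (1981).
-/

open WeierstrassCurve WeierstrassCurve.Affine
open WeierstrassCurve.Affine.Point hiding some
open WeierstrassCurve.QuadraticDescent (incl)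
open scoped Classical

noncomputable section

namespace Summit.BirchSwinnertonDyer.BirchSwinnertonDyer.Theorems.GenusKolyvaginAtTwo.FullVertex.TorsionControl

variable {L : Type*} [Field L] [Algebra ℚ L] [CharZero L] {W : WeierstrassCurve ℚ} [W.IsElliptic] {e₁ e₂ e₃ : ℚ}

/-! ## §6 Square-reflection in a quadratic field ramified at a prime where the values are units up to squares -/

omit [CharZero L] in
/-- **Square-reflection in `ℚ(√D)` ramified at `p`.** If `v_p(D)` is odd, `L = ℚ(r)` with `r² = D`, and `c ∈ ℚ` is
`0` or has EVEN `p`-adic valuation, then `c` a square in `L` ⟹ `c` a square in `ℚ` (the alternative `c ∈ D·ℚ²` has odd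
valuation). [cite: Kramer1981, §1] -/
theorem exists_sq_of_isSquare_quadratic_of_even_padicValRat (p : ℕ) [Fact p.Prime] {D : ℚ}
    (hD : Odd (padicValRat p D)) {r : L} (hr : r ^ 2 = algebraMap ℚ L D)
    (hgen : ∀ w : L, ∃ a b : ℚ, w = algebraMap ℚ L a + algebraMap ℚ L b * r) {c : ℚ}
    (hc : c ≠ 0 → Even (padicValRat p c)) (hsq : ∃ w : L, algebraMap ℚ L c = w ^ 2) : ∃ u : ℚ, c = u ^ 2 := by
  have hD0 : D ≠ 0 := by
    rintro rfl
    rw [padicValRat.zero] at hD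
    exact (Int.not_even_iff_odd.mpr hD) ⟨0, rfl⟩
  obtain ⟨u, hu | hu⟩ := exists_sq_or_mul_sq_of_quadratic hr hgen hsq
  · exact ⟨u, hu⟩
  · by_cases hu0 : u = 0
    · exact ⟨0, by rw [hu, hu0]; ring⟩
    · exfalso
      have hc0 : c ≠ 0 := by rw [hu]; exact mul_ne_zero hD0 (pow_ne_zero _ hu0)
      have hev := hc hc0
      rw [hu, padicValRat.mul hD0 (pow_ne_zero _ hu0), padicValRat.pow] at hev
      obtain ⟨k, hk⟩ := hev
      exact (Int.not_even_iff_odd.mpr hD) ⟨k - padicValRat p u, by push_cast at hk; linarith⟩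

/-- The torsion Kummer value `(e₁−e₂)(e₁−e₃)` has even (indeed zero) `p`-adic valuation when `v_p(e₁−e₂) = v_p(e₁−e₃) = 0`.
[cite: SilvermanAEC2009, Prop. X.1.4] -/
theorem even_padicValRat_torsionKummerValue (p : ℕ) [Fact p.Prime] (h : W.toAffine.SplitTwoTorsion e₁ e₂ e₃)
    (hv₁₂ : padicValRat p (e₁ - e₂) = 0) (hv₁₃ : padicValRat p (e₁ - e₃) = 0) :
    Even (padicValRat p ((e₁ - e₂) * (e₁ - e₃))) := by
  rw [padicValRat.mul (sub_ne_zero.mpr h.ne₁₂) (sub_ne_zero.mpr h.ne₁₃), hv₁₂, hv₁₃]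
  exact ⟨0, rfl⟩

open Literature.NumberTheory.EllipticCurves in
/-- **Kummer values are unramified at good primes** (the image half of Silverman AEC X.1.4, via the tree's
`Curve24A1.even_padicValRat_sub`): if `v_p(eᵢ − eⱼ) = 0` for `i ≠ j`, then for every rational point `(x, y)` with
`x ≠ e₁` the Kummer value `x − e₁` has even `p`-adic valuation. [cite: SilvermanAEC2009, Prop. X.1.4] -/
theorem even_padicValRat_kummerValue_of_nonsingular (p : ℕ) [Fact p.Prime]
    (h : W.toAffine.SplitTwoTorsion e₁ e₂ e₃) (hv₁₂ : padicValRat p (e₁ - e₂) = 0)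
    (hv₁₃ : padicValRat p (e₁ - e₃) = 0) (hv₂₃ : padicValRat p (e₂ - e₃) = 0) {x y : ℚ}
    (hxy : W.toAffine.Nonsingular x y) (hx : x ≠ e₁) : Even (padicValRat p (x - e₁)) := by
  have hv₂₁ : padicValRat p (e₂ - e₁) = 0 := by rw [← neg_sub, padicValRat.neg, hv₁₂]
  have hv₃₁ : padicValRat p (e₃ - e₁) = 0 := by rw [← neg_sub, padicValRat.neg, hv₁₃]
  have hcub := sq_eq_mul_mul_of_equation h hxy.1
  by_cases hy' : y + (W.toAffine.a₁ * x + W.toAffine.a₃) / 2 = 0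
  · -- `x` is a `2`-torsion abscissa: the Kummer value is a difference of roots
    rw [hy', zero_pow two_ne_zero, eq_comm, mul_eq_zero, mul_eq_zero, sub_eq_zero, sub_eq_zero,
      sub_eq_zero] at hcub
    rcases hcub with (hx' | rfl) | rfl
    · exact absurd hx' hx
    · rw [hv₂₁]; exact ⟨0, rfl⟩
    · rw [hv₃₁]; exact ⟨0, rfl⟩
  · exact Curve24A1.even_padicValRat_sub p h.ne₁₂ h.ne₁₃ hv₁₂ hv₁₃ hy' hcub

/-- The hypotheses package of the descent form, for `S = {a ∈ ℚ | a ≠ 0 → v_p(a) even}`: the two torsion Kummer values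
and all `x − e₁`, `x − e₂` of rational points lie in `S` at a good prime `p`. [cite: SilvermanAEC2009, Prop. X.1.4] -/
theorem kummerValues_even_padicValRat (p : ℕ) [Fact p.Prime] (h : W.toAffine.SplitTwoTorsion e₁ e₂ e₃)
    (hv₁₂ : padicValRat p (e₁ - e₂) = 0) (hv₁₃ : padicValRat p (e₁ - e₃) = 0)
    (hv₂₃ : padicValRat p (e₂ - e₃) = 0) :
    ((e₁ - e₂) * (e₁ - e₃) ∈ {a : ℚ | a ≠ 0 → Even (padicValRat p a)}) ∧
    ((e₂ - e₁) * (e₂ - e₃) ∈ {a : ℚ | a ≠ 0 → Even (padicValRat p a)}) ∧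
    (∀ {x y : ℚ}, W.toAffine.Nonsingular x y →
      (x ≠ e₁ → x - e₁ ∈ {a : ℚ | a ≠ 0 → Even (padicValRat p a)}) ∧
      (x ≠ e₂ → x - e₂ ∈ {a : ℚ | a ≠ 0 → Even (padicValRat p a)})) := by
  have hv₂₁ : padicValRat p (e₂ - e₁) = 0 := by rw [← neg_sub, padicValRat.neg, hv₁₂]
  have hv₃₂ : padicValRat p (e₃ - e₂) = 0 := by rw [← neg_sub, padicValRat.neg, hv₂₃]
  refine ⟨fun _ => even_padicValRat_torsionKummerValue p h hv₁₂ hv₁₃,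
    fun _ => even_padicValRat_torsionKummerValue p h.swap₁₂ hv₂₁ hv₂₃, fun hxy => ⟨?_, ?_⟩⟩
  · exact fun hx _ => even_padicValRat_kummerValue_of_nonsingular p h hv₁₂ hv₁₃ hv₂₃ hxy hx
  · exact fun hx _ => even_padicValRat_kummerValue_of_nonsingular p h.swap₁₂ hv₂₁ hv₂₃ hv₁₃ hxy hx

/-! ## §6b Lemma 11.1 for `L = ℚ(√D)` ramified at a good prime — unconditional -/

/-- **Lemma 11.1 (i) for `K″ = ℚ(√D)` ramified at a good prime — unconditional.** Let `E/ℚ` have rational `2`-torsion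
`e₁, e₂, e₃` (any model), `p` a prime with `v_p(eᵢ − eⱼ) = 0` (`i ≠ j`), and `L = ℚ(r)`, `r² = D` with `v_p(D)` odd
(GK2 / LINE 49: `D = D″ = −p₀M₀`, `p = p₀` the Heegner prime, `p₀ ∤ 2N₀`).  Then `E(ℚ) ∩ 2E(L) = 2E(ℚ)`.
[cite: SilvermanAEC2009, Prop. X.1.4] [cite: Kramer1981, §1] -/
theorem exists_add_self_of_incl_quadratic [DecidableEq ℚ] (h : W.toAffine.SplitTwoTorsion e₁ e₂ e₃) (p : ℕ)
    [Fact p.Prime] (hv₁₂ : padicValRat p (e₁ - e₂) = 0) (hv₁₃ : padicValRat p (e₁ - e₃) = 0)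
    (hv₂₃ : padicValRat p (e₂ - e₃) = 0) {D : ℚ} (hD : Odd (padicValRat p D)) {r : L}
    (hr : r ^ 2 = algebraMap ℚ L D) (hgen : ∀ w : L, ∃ a b : ℚ, w = algebraMap ℚ L a + algebraMap ℚ L b * r)
    (R : W.toAffine.Point) (hR : ∃ Q : (W.baseChange L).toAffine.Point, Q + Q = incl L W R) :
    ∃ P : W.toAffine.Point, P + P = R := by
  obtain ⟨hS₁, hS₂, hS⟩ := kummerValues_even_padicValRat p h hv₁₂ hv₁₃ hv₂₃
  obtain ⟨P, hP⟩ := exists_add_self_of_map h _ hS₁ hS₂ hS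
    (fun a ha hsq => exists_sq_of_isSquare_quadratic_of_even_padicValRat p hD hr hgen ha hsq) R hR
  -- the group law on `E(ℚ)` is polymorphic in the (irrelevant) `DecidableEq ℚ` instance
  exact ⟨P, by convert hP⟩

/-- **Lemma 11.1 (ii) for `K″ = ℚ(√D)` ramified at a good prime — unconditional:** `E(L)[2^∞] = E(ℚ)[2^∞]`
(the `2`-primary torsion does not grow). [cite: SilvermanAEC2009, Prop. X.1.4] [cite: Kramer1981, §1] -/
theorem exists_incl_eq_of_two_pow_smul_eq_zero_quadratic (h : W.toAffine.SplitTwoTorsion e₁ e₂ e₃) (p : ℕ)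
    [Fact p.Prime] (hv₁₂ : padicValRat p (e₁ - e₂) = 0) (hv₁₃ : padicValRat p (e₁ - e₃) = 0)
    (hv₂₃ : padicValRat p (e₂ - e₃) = 0) {D : ℚ} (hD : Odd (padicValRat p D)) {r : L}
    (hr : r ^ 2 = algebraMap ℚ L D) (hgen : ∀ w : L, ∃ a b : ℚ, w = algebraMap ℚ L a + algebraMap ℚ L b * r)
    (Q : (W.baseChange L).toAffine.Point) {m : ℕ} (hQ : 2 ^ m • Q = 0) : ∃ P : W.toAffine.Point, incl L W P = Q := by
  obtain ⟨hS₁, hS₂, hS⟩ := kummerValues_even_padicValRat p h hv₁₂ hv₁₃ hv₂₃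
  obtain ⟨P, hP⟩ := mem_range_map_of_two_pow_smul_eq_zero h _ hS₁ hS₂ hS
    (fun a ha hsq => exists_sq_of_isSquare_quadratic_of_even_padicValRat p hD hr hgen ha hsq) Q hQ
  exact ⟨P, hP⟩

/-- **Lemma 11.1 (iii) for `K″ = ℚ(√D)` ramified at a good prime — unconditional:** a half in `E(L)` of a rational point
is rational. [cite: SilvermanAEC2009, Prop. X.1.4] [cite: Kramer1981, §1] -/
theorem exists_incl_eq_of_add_self_eq_incl_quadratic (h : W.toAffine.SplitTwoTorsion e₁ e₂ e₃) (p : ℕ)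
    [Fact p.Prime] (hv₁₂ : padicValRat p (e₁ - e₂) = 0) (hv₁₃ : padicValRat p (e₁ - e₃) = 0)
    (hv₂₃ : padicValRat p (e₂ - e₃) = 0) {D : ℚ} (hD : Odd (padicValRat p D)) {r : L}
    (hr : r ^ 2 = algebraMap ℚ L D) (hgen : ∀ w : L, ∃ a b : ℚ, w = algebraMap ℚ L a + algebraMap ℚ L b * r)
    (R : W.toAffine.Point) (Q : (W.baseChange L).toAffine.Point) (hQ : Q + Q = incl L W R) :
    ∃ P : W.toAffine.Point, incl L W P = Q := by
  obtain ⟨hS₁, hS₂, hS⟩ := kummerValues_even_padicValRat p h hv₁₂ hv₁₃ hv₂₃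
  obtain ⟨P, hP⟩ := mem_range_map_of_add_self_eq_map h _ hS₁ hS₂ hS
    (fun a ha hsq => exists_sq_of_isSquare_quadratic_of_even_padicValRat p hD hr hgen ha hsq) R Q hQ
  exact ⟨P, hP⟩

/-! ## §7 The GK2 / LINE 49 cell reading: `K″ = ℚ(√−p₀M₀)`, integral full-`2`-torsion base -/

/-- Integral abscissae with `p₀ ∤ a − b` have `v_{p₀}(a − b) = 0` in `ℚ`. [cite: SilvermanAEC2009, Prop. X.1.4] -/
theorem padicValRat_intCast_sub_eq_zero (p₀ : ℕ) [Fact p₀.Prime] {a b : ℤ} (hab : ¬ (p₀ : ℤ) ∣ a - b) :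
    padicValRat p₀ ((a : ℚ) - (b : ℚ)) = 0 := by
  rw [← Int.cast_sub, padicValRat.of_int, padicValInt.eq_zero_of_not_dvd hab, Nat.cast_zero]

/-- `v_{p₀}(−p₀M₀)` is odd (indeed `1`) when `p₀ ∤ M₀ ≠ 0`. [cite: SilvermanAEC2009, Prop. X.1.4] -/
theorem odd_padicValRat_neg_mul (p₀ M₀ : ℕ) [hp : Fact p₀.Prime] (hM : ¬ p₀ ∣ M₀) (hM0 : M₀ ≠ 0) :
    Odd (padicValRat p₀ (-((p₀ * M₀ : ℕ) : ℚ))) := by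
  rw [padicValRat.neg, padicValRat.of_nat, padicValNat.mul hp.out.ne_zero hM0,
    padicValNat.self hp.out.one_lt, padicValNat.eq_zero_of_not_dvd hM]
  exact ⟨0, rfl⟩

/-- **Torsion control over `K″ = ℚ(√−p₀M₀)` for an integral full-`2`-torsion base, (i) `2`-saturation:** `E/ℚ` a
Weierstrass model with rational `2`-torsion abscissae `e₁, e₂, e₃ ∈ ℤ`, `p₀` a prime with `p₀ ∤ (e₁−e₂)(e₁−e₃)(e₂−e₃)`
and `p₀ ∤ M₀ ≠ 0`, `L ⊇ ℚ` generated by `r` with `r² = −p₀M₀`.  Then `E(ℚ) ∩ 2E(L) = 2E(ℚ)`.  Unconditional.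
[cite: SilvermanAEC2009, Prop. X.1.4] [cite: Kramer1981, §1] -/
theorem exists_add_self_of_incl_cell [DecidableEq ℚ] {e₁ e₂ e₃ : ℤ}
    (h : W.toAffine.SplitTwoTorsion (e₁ : ℚ) (e₂ : ℚ) (e₃ : ℚ)) (p₀ M₀ : ℕ) [Fact p₀.Prime]
    (h₁₂ : ¬ (p₀ : ℤ) ∣ e₁ - e₂) (h₁₃ : ¬ (p₀ : ℤ) ∣ e₁ - e₃) (h₂₃ : ¬ (p₀ : ℤ) ∣ e₂ - e₃)
    (hM : ¬ p₀ ∣ M₀) (hM0 : M₀ ≠ 0) {r : L} (hr : r ^ 2 = algebraMap ℚ L (-((p₀ * M₀ : ℕ) : ℚ)))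
    (hgen : ∀ w : L, ∃ a b : ℚ, w = algebraMap ℚ L a + algebraMap ℚ L b * r)
    (R : W.toAffine.Point) (hR : ∃ Q : (W.baseChange L).toAffine.Point, Q + Q = incl L W R) :
    ∃ P : W.toAffine.Point, P + P = R :=
  exists_add_self_of_incl_quadratic h p₀ (padicValRat_intCast_sub_eq_zero p₀ h₁₂)
    (padicValRat_intCast_sub_eq_zero p₀ h₁₃) (padicValRat_intCast_sub_eq_zero p₀ h₂₃)
    (odd_padicValRat_neg_mul p₀ M₀ hM hM0) hr hgen R hR

/-- **Torsion control over `K″ = ℚ(√−p₀M₀)`, (ii): `E(L)[2^∞] = E(ℚ)[2^∞]`** — the `2`-primary torsion does not grow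
in the genus field's quadratic layer (memo #4 §11/§12; F6 table `torsK = 4`).  Unconditional; odd torsion not addressed.
[cite: SilvermanAEC2009, Prop. X.1.4] [cite: Kramer1981, §1] -/
theorem exists_incl_eq_of_two_pow_smul_eq_zero_cell {e₁ e₂ e₃ : ℤ}
    (h : W.toAffine.SplitTwoTorsion (e₁ : ℚ) (e₂ : ℚ) (e₃ : ℚ)) (p₀ M₀ : ℕ) [Fact p₀.Prime]
    (h₁₂ : ¬ (p₀ : ℤ) ∣ e₁ - e₂) (h₁₃ : ¬ (p₀ : ℤ) ∣ e₁ - e₃) (h₂₃ : ¬ (p₀ : ℤ) ∣ e₂ - e₃)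
    (hM : ¬ p₀ ∣ M₀) (hM0 : M₀ ≠ 0) {r : L} (hr : r ^ 2 = algebraMap ℚ L (-((p₀ * M₀ : ℕ) : ℚ)))
    (hgen : ∀ w : L, ∃ a b : ℚ, w = algebraMap ℚ L a + algebraMap ℚ L b * r)
    (Q : (W.baseChange L).toAffine.Point) {m : ℕ} (hQ : 2 ^ m • Q = 0) : ∃ P : W.toAffine.Point, incl L W P = Q :=
  exists_incl_eq_of_two_pow_smul_eq_zero_quadratic h p₀ (padicValRat_intCast_sub_eq_zero p₀ h₁₂)
    (padicValRat_intCast_sub_eq_zero p₀ h₁₃) (padicValRat_intCast_sub_eq_zero p₀ h₂₃)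
    (odd_padicValRat_neg_mul p₀ M₀ hM hM0) hr hgen Q hQ

/-- **Torsion control over `K″ = ℚ(√−p₀M₀)`, (iii): halves in `E(L)` of rational points are rational.**  Unconditional.
[cite: SilvermanAEC2009, Prop. X.1.4] [cite: Kramer1981, §1] -/
theorem exists_incl_eq_of_add_self_eq_incl_cell {e₁ e₂ e₃ : ℤ}
    (h : W.toAffine.SplitTwoTorsion (e₁ : ℚ) (e₂ : ℚ) (e₃ : ℚ)) (p₀ M₀ : ℕ) [Fact p₀.Prime]
    (h₁₂ : ¬ (p₀ : ℤ) ∣ e₁ - e₂) (h₁₃ : ¬ (p₀ : ℤ) ∣ e₁ - e₃) (h₂₃ : ¬ (p₀ : ℤ) ∣ e₂ - e₃)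
    (hM : ¬ p₀ ∣ M₀) (hM0 : M₀ ≠ 0) {r : L} (hr : r ^ 2 = algebraMap ℚ L (-((p₀ * M₀ : ℕ) : ℚ)))
    (hgen : ∀ w : L, ∃ a b : ℚ, w = algebraMap ℚ L a + algebraMap ℚ L b * r)
    (R : W.toAffine.Point) (Q : (W.baseChange L).toAffine.Point) (hQ : Q + Q = incl L W R) :
    ∃ P : W.toAffine.Point, incl L W P = Q :=
  exists_incl_eq_of_add_self_eq_incl_quadratic h p₀ (padicValRat_intCast_sub_eq_zero p₀ h₁₂)
    (padicValRat_intCast_sub_eq_zero p₀ h₁₃) (padicValRat_intCast_sub_eq_zero p₀ h₂₃)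
    (odd_padicValRat_neg_mul p₀ M₀ hM hM0) hr hgen R Q hQ

end Summit.BirchSwinnertonDyer.BirchSwinnertonDyer.Theorems.GenusKolyvaginAtTwo.FullVertex.TorsionControl

end
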